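import Summits.BirchSwinnertonDyer.BirchSwinnertonDyer.Theorems.SignedLowerHalvesKobayashiMainConjectureSmallImageRationalRigidity
import HarnessLib

/-!
# Route `SignedLowerHalves`, crux `KobayashiMainConjectureSmallImage` (item stmt-BirchSwinnertonDyer-19002):
# the EXACT LIMIT of rational rigidity — a unit-content fudge factor is NOT absorbed
# (cell `bsd-ssimc`, seat `bsd-line-slh-p3` gen 6, line `birth_acns` v4; THEOREMS ONLY; helper `--supports` item 4)

`…Theorems.SmallImageRationalRigidity.le_span_of_anchor_rat` (p625973) says: in `𝒪_{ℂ_p}⟦T₂⟧⟦T₁⟧`, if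
`I` is principal, `C (C β) · G ∈ I` for a NONZERO CONSTANT `β`, `I|_{T₁=0} ⊆ (G|_{T₁=0})` and `G|_{T₁=0}` has
unit content, then `I ⊆ (G)`. This is why the two-variable Euler-system stub of line `birth_acns` (T2_rat,
`BirthAcns.stub_ES2rat_ns`) and line `ratlift`'s F1 (crux 20728) may be stated RATIONALLY, «`p^a · G ∈ ch`».

THIS FILE records, in the kernel, that the hypothesis «nonzero constant» cannot be relaxed to «multiplier
`h` whose restriction `h|_{T₁=0}` has unit content (`μ(h⁻) = 0`)» — the shape an Euler-system bound with a
NON-`p`-power error term (Euler factors `∏ P_w(γ_w)`, `(γ_v − 1)`-type `H⁰` factors) would have: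

* `not_dvd_witness` — over ANY nontrivial commutative ring `R`, in `R⟦T₂⟧⟦T₁⟧` (outer variable `X = T₁`,
  inner `C X = T₂`): `G = T₂ + T₁` does not divide `c = T₂ + T₁²`, although `c|_{T₁=0} = G|_{T₁=0} = T₂`
  has unit content and `c · G ∈ (c)`;
* `not_rigidity_unitContentFudge` — hence the «unit-content fudge» strengthening of `le_span_of_anchor_rat`
  over `𝒪_{ℂ_p}` is FALSE (witness `I = (c)`, `h = c`, `G` as above).

So T2_rat / F1 must stay «`p`-power (or nonzero constant) times `G`» (= the `Λ ⊗ ℚ_p` statement); Euler-factor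
fudge belongs to Σ-imprimitive statements on BOTH sides of the main conjecture, where it cancels, not to the
rational Euler-system stub (cf. line card `Cruxes/TwoVariableEulerSystemDivisibility/Lines/ratlift.md`, "NON-p fudge
is NOT absorbed by p^a"). HONEST SCOPE: pure commutative algebra; crux 4 OPEN; BSD is not proved by any of this.

References: [Rubin2000] Thm. 2.3.3–2.3.4 (the `p^t` shape of a rational Euler-system bound);
[BurungaleCastellaSkinner2025] Prop. 4.2.2 (`μ(G⁻) = 0`, the anchor's unit content); tree: p625973, p627271,
`Cruxes/KobayashiMainConjectureSmallImage/Lines/birth-MEMO-slh-p3-6.md` §2(c).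
-/

-- D-0017: single-problem summit, the namespace repeats the problem name by design.
set_option linter.dupNamespace false
set_option autoImplicit false

noncomputable section

open scoped Classical

namespace Summit.BirchSwinnertonDyer.BirchSwinnertonDyer.Theorems.SmallImageRigidityLimit

open PowerSeries Literature.NumberTheory.EllipticCurves Literature.NumberTheory.EllipticCurves.GreenbergVatsal2000

/-! ## §1 The witness over any nontrivial commutative ring -/

section AnyRing

variable {R : Type*} [CommRing R] [Nontrivial R]

/-- In `R⟦T₂⟧⟦T₁⟧` (outer `X = T₁`, inner `C X = T₂`), `T₂ + T₁ ∤ T₂ + T₁²`: if `T₂ + T₁² = (T₂ + T₁)·k`, the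
`T₁`-degree-`0` part gives `T₂ = T₂·k₀`, whose `T₂`-degree-`1` coefficient is `1 = k₀(0)`; the `T₁`-degree-`1`
part gives `0 = T₂·k₁ + k₀`, whose constant term is `0 = k₀(0)`; so `0 = 1`. [folklore] -/
theorem not_dvd_witness :
    ¬ ((C (X : PowerSeries R) + X : PowerSeries (PowerSeries R)) ∣ (C (X : PowerSeries R) + X ^ 2)) := by
  rintro ⟨k, hk⟩
  -- `T₁`-degree 0: `T₂ = T₂ · k₀`
  have h0 := congrArg (constantCoeff (R := PowerSeries R)) hk
  simp only [map_add, map_pow, map_mul, constantCoeff_C, constantCoeff_X, add_zero, zero_pow two_ne_zero] at h0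
  -- inner degree 1 of `T₂ = T₂ · k₀`: `1 = coeff₀ k₀`
  have h01 := congrArg (coeff (R := R) 1) h0
  rw [coeff_one_X, coeff_succ_X_mul] at h01
  -- `T₁`-degree 1: `0 = T₂ · k₁ + k₀`
  have h1 := congrArg (coeff (R := PowerSeries R) 1) hk
  rw [map_add, coeff_C, if_neg one_ne_zero, coeff_X_pow, if_neg (by decide), add_mul, map_add, coeff_C_mul,
    coeff_succ_X_mul, zero_add] at h1
  -- constant term of `0 = T₂ · k₁ + k₀`: `0 = 0 + 1`
  have h10 := congrArg (constantCoeff (R := R)) h1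
  rw [map_zero, map_add, map_mul, constantCoeff_X, zero_mul, zero_add] at h10
  -- `coeff 0 = constantCoeff` on both sides
  rw [coeff_zero_eq_constantCoeff_apply] at h01 h10
  exact one_ne_zero (h01.trans h10.symm)

omit [Nontrivial R] in
/-- The restriction `T₁ ↦ 0` of both `T₂ + T₁` and `T₂ + T₁²` is `T₂`, which has unit content (coefficient `1`
in inner degree `1`). [folklore] -/
theorem hasUnitContent_X : HasUnitContent (X : PowerSeries R) :=
  ⟨1, by rw [coeff_one_X]; exact isUnit_one⟩

omit [Nontrivial R] in
/-- `(T₂ + T₁)|_{T₁=0} = T₂`. [folklore] -/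
theorem constantCoeff_G : constantCoeff (R := PowerSeries R) (C (X : PowerSeries R) + X) = X := by
  rw [map_add, constantCoeff_C, constantCoeff_X, add_zero]

omit [Nontrivial R] in
/-- `(T₂ + T₁²)|_{T₁=0} = T₂`. [folklore] -/
theorem constantCoeff_c : constantCoeff (R := PowerSeries R) (C (X : PowerSeries R) + X ^ 2) = X := by
  rw [map_add, map_pow, constantCoeff_C, constantCoeff_X, zero_pow two_ne_zero, add_zero]

end AnyRing

/-! ## §2 The strengthening of `le_span_of_anchor_rat` by a unit-content fudge factor is false over `𝒪_{ℂ_p}` -/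

variable {p : ℕ} [Fact p.Prime]

/-- **Unit-content fudge is NOT absorbed by rational rigidity.** The statement obtained from
`SmallImageRationalRigidity.le_span_of_anchor_rat` by replacing the nonzero constant multiplier `C (C β)` with an
arbitrary `h ∈ 𝒪_{ℂ_p}⟦T₂⟧⟦T₁⟧` such that `h|_{T₁=0}` has unit content is FALSE: witness `G = T₂ + T₁`, `h = c = T₂ + T₁²`,
`I = (c)` — `h·G ∈ I`, `I|_{T₁=0} = (T₂) = (G|_{T₁=0})`, `μ(G|_{T₁=0}) = μ(h|_{T₁=0}) = 0`, yet `G ∤ c`.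
[cite: Rubin2000, Thm. 2.3.4 (the rational bound has the shape p^t, a constant — the only shape rigidity absorbs)] -/
theorem not_rigidity_unitContentFudge :
    ¬ ∀ (I : Ideal (PowerSeries (PowerSeries (PadicComplexInt p)))) (G h : PowerSeries (PowerSeries (PadicComplexInt p))),
      I.IsPrincipal → HasUnitContent (constantCoeff (R := PowerSeries (PadicComplexInt p)) h) → h * G ∈ I →
      I.map (constantCoeff (R := PowerSeries (PadicComplexInt p))) ≤
        Ideal.span {constantCoeff (R := PowerSeries (PadicComplexInt p)) G} →
      HasUnitContent (constantCoeff (R := PowerSeries (PadicComplexInt p)) G) → I ≤ Ideal.span {G} := by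
  intro H
  set G : PowerSeries (PowerSeries (PadicComplexInt p)) := C (X : PowerSeries (PadicComplexInt p)) + X with hGdef
  set c : PowerSeries (PowerSeries (PadicComplexInt p)) := C (X : PowerSeries (PadicComplexInt p)) + X ^ 2
    with hcdef
  have hGc : constantCoeff (R := PowerSeries (PadicComplexInt p)) G = X := constantCoeff_G
  have hcc : constantCoeff (R := PowerSeries (PadicComplexInt p)) c = X := constantCoeff_c
  have hle : Ideal.span {c} ≤ Ideal.span {G} := by
    refine H (Ideal.span {c}) G c ⟨⟨c, rfl⟩⟩ ?_ (Ideal.mem_span_singleton.mpr (Dvd.intro G rfl)) ?_ ?_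
    · rw [hcc]; exact hasUnitContent_X
    · rw [Ideal.map_span, Set.image_singleton, hcc, hGc]
    · rw [hGc]; exact hasUnitContent_X
  have hdvd : G ∣ c := Ideal.mem_span_singleton.mp (hle (Ideal.mem_span_singleton_self c))
  exact not_dvd_witness hdvd

end Summit.BirchSwinnertonDyer.BirchSwinnertonDyer.Theorems.SmallImageRigidityLimit

end
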